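import Mathlib
import HarnessLib
import Summits.QuantumFields.YangMills.Theses.FradkinShenkerFlow
import Summits.QuantumFields.YangMills.Theses.ConvexGribovBody
import Summits.QuantumFields.YangMills.Theses.InfraredLiouville

/-!
# Dominance checks among the UV-leg siblings (crux-ideate 9443, ideator 2)

* `crux_of_8782` : `ConvexGribovBody.ContinuumLegGivenGap → FradkinShenkerFlow.ClusteringToYangMills`
  (pure logic: 8782's hypothesis allows a torus-size threshold `S₁(β)`, the crux's does not).
-/

namespace Summit.QuantumFields.YangMills.Cruxes.ClusteringToYangMills.SketchDominance

open Literature.MathematicalPhysics.QuantumFieldTheory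
open Summit.QuantumFields.YangMills.Theses

theorem crux_of_8782 (h : ConvexGribovBody.ContinuumLegGivenGap) :
    FradkinShenkerFlow.ClusteringToYangMills := by
  intro hEC G _ _ _ _ hG
  letI : MeasurableSpace G := borel G
  haveI : BorelSpace G := ⟨rfl⟩
  refine h G hG (fun r => ?_)
  obtain ⟨β₀, hβ₀⟩ := hEC G hG r
  refine ⟨β₀, fun β hβ => ?_⟩
  obtain ⟨m, hm, hAB⟩ := hβ₀ β hβ
  exact ⟨m, hm, 0, fun A B => (hAB A B).imp fun C hC S n _ hn => hC S n hn⟩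

end Summit.QuantumFields.YangMills.Cruxes.ClusteringToYangMills.SketchDominance
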